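import Mathlib
import HarnessLib
import Summits.HubbardSuperconductivity.HubbardSuperconductivity.Theorems.BalabanIRBirGappedPhaseReductionRSlavedTrotterBlocks

/-!
# BalabanIR reduction `BirGappedPhaseReductionR` (stmt-14846): slaved block pair field — EQUAL-TIME field two-point function, the exact finite-`M` identity

Support file (`--supports stmt-HubbardSuperconductivity-14846`; prover seat 2, session 11), sixth part
of the slaved pair-field dictionary (card `slaved-pair-field-os-dictionary`; TRIAGE-r1-3 T5: the
transfer must be cashed on EQUAL-TIME slices).  Blocks `B : Fin m → Mat_n(ℂ)`, single-block slices
`S_b(k)` (any family `S : Fin m → Fin 4 → Mat_n(ℂ)` here), transfer factor `G` (think `e^{-aH'}`),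
field values `φ_k = r iᵏ`.  The EQUAL-TIME field two-point function at the time-zero slice between
blocks `b₁ ≠ b₂` is the configuration average of `conj φ_{P 0 b₁} · φ_{P 0 b₂}` against the fully
slaved weight `Π_τ [G Π_b S_b(P τ b)]`.  This file proves the exact finite-`M` identity

  `(1/4)^{m(M+1)} Σ_P (conj φ_{P0b₁} φ_{P0b₂}) • Π_τ [G Π_b S_b(Pτb)] = (G · Π_b E_b) · (G · Π_b S̄_b)^M`
  (`sum_insertion_slavedWeightBlocks_eq`),

where `E_b = ¼Σ_k conj φ_k • S_{b₁}(k)` for `b = b₁`, `¼Σ_k φ_k • S_{b₂}(k)` for `b = b₂`, and the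
plain averaged slice `S̄_b = ¼Σ_k S_b(k)` otherwise (`insertionSlice`-shaped sums, written with
`if`s), by distributivity of ordered products over configuration sums in time
(`sum_prod_ofFn_eq_prod_ofFn_sum`, `…Blocks`) and the weighted block distributivity
`sum_smul_prod_ofFn_eq` proved here.  Also: ordered products with all but one / two factors equal
to `1` (`prod_ofFn_ite_one`, `prod_ofFn_ite_ite_one`), used to read off the limit `B_{b₁}ᴴ B_{b₂}` in
the companion file `…EqualTimeLimit`.
-/

noncomputable section

namespace Summit.HubbardSuperconductivity.HubbardSuperconductivity.Theorems

open scoped Matrix.Norms.L2Operator ComplexConjugate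
open Matrix Filter Topology NormedSpace
open Literature.MathematicalPhysics.QuantumLattice

variable {n : Type*} [Fintype n] [DecidableEq n]

/-! ### Weighted distributivity over the blocks -/

/-- Block-dependent scalars pull out of ordered products: `Π_b (c_b • S_b) = (Π_b c_b) • Π_b S_b`.
[folklore] -/
theorem prod_ofFn_smul' {R : Type*} [Ring R] [Algebra ℂ R] :
    ∀ {m : ℕ} (c : Fin m → ℂ) (S : Fin m → R),
      (List.ofFn fun b => c b • S b).prod = (∏ b, c b) • (List.ofFn S).prod := by
  intro m
  induction m with
  | zero => intro c S; simp
  | succ m ih =>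
    intro c S
    rw [List.ofFn_succ, List.prod_cons, List.ofFn_succ, List.prod_cons, ih, Fin.prod_univ_succ,
      smul_mul_assoc, mul_smul_comm, smul_smul]

/-- **Weighted distributivity**: `Σ_p (Π_b c_b(p_b)) • Π_b S_b(p_b) = Π_b Σ_k c_b(k) • S_b(k)`.
[folklore] -/
theorem sum_smul_prod_ofFn_eq {R : Type*} [Ring R] [Algebra ℂ R] {ι : Type*} [Fintype ι] {m : ℕ}
    (c : Fin m → ι → ℂ) (S : Fin m → ι → R) :
    ∑ p : Fin m → ι, (∏ b, c b (p b)) • (List.ofFn fun b => S b (p b)).prod =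
      (List.ofFn fun b => ∑ k, c b k • S b k).prod := by
  rw [← sum_prod_ofFn_eq_prod_ofFn_sum (fun b k => c b k • S b k)]
  refine Finset.sum_congr rfl fun p _ => ?_
  rw [prod_ofFn_smul']

/-! ### Ordered products with all but one or two factors trivial -/

/-- `Π_b (if b = j then u else 1) = u` (ordered product). [folklore] -/
theorem prod_ofFn_ite_one {R : Type*} [Monoid R] :
    ∀ {m : ℕ} (j : Fin m) (u : R), (List.ofFn fun b => if b = j then u else 1).prod = u := by
  intro m
  induction m with
  | zero => intro j; exact j.elim0
  | succ m ih =>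
    intro j u
    rw [List.ofFn_succ, List.prod_cons]
    refine Fin.cases ?_ (fun i => ?_) j
    · rw [if_pos rfl]
      have h : (List.ofFn fun b : Fin m => if (b.succ : Fin (m + 1)) = 0 then u else 1) =
          List.ofFn fun _ : Fin m => (1 : R) :=
        congrArg List.ofFn (funext fun b => if_neg (Fin.succ_ne_zero b))
      rw [h, List.ofFn_const, List.prod_replicate, one_pow, mul_one]
    · rw [if_neg (Fin.succ_ne_zero i).symm, one_mul]
      have h : (List.ofFn fun b : Fin m => if (b.succ : Fin (m + 1)) = i.succ then u else 1) =
          List.ofFn fun b : Fin m => if b = i then u else 1 :=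
        congrArg List.ofFn (funext fun b => by simp only [Fin.succ_inj])
      rw [h, ih]

/-- `Π_b (if b = i then u else if b = j then v else 1) = u * v` for `i < j` (ordered product).
[folklore] -/
theorem prod_ofFn_ite_ite_one {R : Type*} [Monoid R] :
    ∀ {m : ℕ} (i j : Fin m), i < j → ∀ (u v : R),
      (List.ofFn fun b => if b = i then u else if b = j then v else 1).prod = u * v := by
  intro m
  induction m with
  | zero => intro i; exact i.elim0
  | succ m ih =>
    intro i j hij u v
    rw [List.ofFn_succ, List.prod_cons]
    revert hij
    refine Fin.cases ?_ (fun i' => ?_) i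
    · intro hij
      -- `i = 0`, so `j = succ j'`
      obtain ⟨j', rfl⟩ : ∃ j', j = Fin.succ j' := Fin.eq_succ_of_ne_zero (ne_of_gt hij)
      rw [if_pos rfl]
      have h : (List.ofFn fun b : Fin m =>
          if (b.succ : Fin (m + 1)) = 0 then u else if (b.succ : Fin (m + 1)) = j'.succ then v else 1) =
          List.ofFn fun b : Fin m => if b = j' then v else 1 :=
        congrArg List.ofFn (funext fun b => by
          rw [if_neg (Fin.succ_ne_zero b)]; simp only [Fin.succ_inj])
      rw [h, prod_ofFn_ite_one]
    · intro hij
      obtain ⟨j', rfl⟩ : ∃ j', j = Fin.succ j' :=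
        Fin.eq_succ_of_ne_zero (ne_of_gt (lt_of_le_of_lt (Fin.zero_le _) hij))
      rw [if_neg (Fin.succ_ne_zero i').symm, if_neg (Fin.succ_ne_zero j').symm, one_mul]
      have h : (List.ofFn fun b : Fin m =>
          if (b.succ : Fin (m + 1)) = i'.succ then u else if (b.succ : Fin (m + 1)) = j'.succ then v else 1) =
          List.ofFn fun b : Fin m => if b = i' then u else if b = j' then v else 1 :=
        congrArg List.ofFn (funext fun b => by simp only [Fin.succ_inj])
      rw [h, ih i' j' (Fin.succ_lt_succ_iff.mp hij)]

/-! ### The exact finite-`M` identity for the equal-time field two-point function -/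

/-- Product of the insertion selectors: `Π_b sel_b(p_b) = conj φ_{p b₁} · φ_{p b₂}` for `b₁ ≠ b₂`,
where `sel_b = conj φ` at `b₁`, `φ` at `b₂`, `1` elsewhere. [folklore] -/
theorem prod_selector_eq {m : ℕ} (b₁ b₂ : Fin m) (hb : b₁ ≠ b₂) (f g : Fin 4 → ℂ) (p : Fin m → Fin 4) :
    ∏ b, (if b = b₁ then f (p b) else if b = b₂ then g (p b) else 1) = f (p b₁) * g (p b₂) := by
  rw [Finset.prod_eq_mul b₁ b₂ hb]
  · rw [if_pos rfl, if_neg hb.symm, if_pos rfl]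
  · intro c _ hc
    rw [if_neg hc.1, if_neg hc.2]
  · intro h; exact absurd (Finset.mem_univ _) h
  · intro h; exact absurd (Finset.mem_univ _) h

/-- **Equal-time field two-point function against the fully slaved many-block weight: the exact
finite-`M` identity.** For any `G`, slice families `S : Fin m → Fin 4 → Mat_n(ℂ)`, coefficient
functions `f, g : Fin 4 → ℂ` (think `conj φ_k`, `φ_k`) and blocks `b₁ ≠ b₂`:
`(1/4)^{m(M+1)} • Σ_{P : Fin (M+1) → Fin m → Fin 4} (f(P 0 b₁) g(P 0 b₂)) • Π_τ [G · Π_b S_b(P τ b)]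
 = (G · Π_b E_b) · (G · Π_b ¼Σ_k S_b k)^M`, with the insertion slices
`E_b = Σ_k ¼(if b = b₁ then f k else if b = b₂ then g k else 1) • S_b k`. [folklore] -/
theorem sum_insertion_slavedWeightBlocks_eq {m M : ℕ} (G : Matrix n n ℂ) (S : Fin m → Fin 4 → Matrix n n ℂ)
    (f g : Fin 4 → ℂ) (b₁ b₂ : Fin m) (hb : b₁ ≠ b₂) :
    (1 / 4 : ℂ) ^ (m * (M + 1)) • ∑ P : Fin (M + 1) → Fin m → Fin 4,
        (f (P 0 b₁) * g (P 0 b₂)) • (List.ofFn fun τ => G * (List.ofFn fun b => S b (P τ b)).prod).prod =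
      (G * (List.ofFn fun b => ∑ k, ((1 / 4 : ℂ) *
          (if b = b₁ then f k else if b = b₂ then g k else 1)) • S b k).prod) *
        (G * (List.ofFn fun b => (1 / 4 : ℂ) • ∑ k, S b k).prod) ^ M := by
  -- time distributivity with the `τ`-dependent family
  -- `F τ p = ((if τ = 0 then f (p b₁) g (p b₂) else 1) * (1/4)^m) • (G * Π_b S_b (p b))`
  have h := sum_prod_ofFn_eq_prod_ofFn_sum
    (fun (τ : Fin (M + 1)) (p : Fin m → Fin 4) =>
      ((if τ = 0 then f (p b₁) * g (p b₂) else 1) * (1 / 4 : ℂ) ^ m) •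
        (G * (List.ofFn fun b => S b (p b)).prod))
  -- left side of `h` is the left side of the claim
  have hl : ∀ P : Fin (M + 1) → Fin m → Fin 4,
      (List.ofFn fun τ : Fin (M + 1) => ((if τ = 0 then f (P τ b₁) * g (P τ b₂) else 1) * (1 / 4 : ℂ) ^ m) •
        (G * (List.ofFn fun b => S b (P τ b)).prod)).prod =
        ((f (P 0 b₁) * g (P 0 b₂)) * (1 / 4 : ℂ) ^ (m * (M + 1))) •
          (List.ofFn fun τ => G * (List.ofFn fun b => S b (P τ b)).prod).prod := by
    intro P
    rw [prod_ofFn_smul', Fin.prod_univ_succ]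
    congr 1
    simp only [Fin.succ_ne_zero, ↓reduceIte, one_mul, Finset.prod_const, Finset.card_univ,
      Fintype.card_fin, ← pow_mul]
    ring
  simp only [hl] at h
  rw [show ∑ P : Fin (M + 1) → Fin m → Fin 4, ((f (P 0 b₁) * g (P 0 b₂)) * (1 / 4 : ℂ) ^ (m * (M + 1))) •
      (List.ofFn fun τ => G * (List.ofFn fun b => S b (P τ b)).prod).prod =
      (1 / 4 : ℂ) ^ (m * (M + 1)) • ∑ P : Fin (M + 1) → Fin m → Fin 4, (f (P 0 b₁) * g (P 0 b₂)) •
        (List.ofFn fun τ => G * (List.ofFn fun b => S b (P τ b)).prod).prod by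
    rw [Finset.smul_sum]
    refine Finset.sum_congr rfl fun P _ => ?_
    rw [smul_smul, mul_comm]] at h
  rw [h, List.ofFn_succ, List.prod_cons]
  congr 1
  · -- the time-zero slice with the two insertions
    simp only [↓reduceIte, ← mul_smul_comm]
    rw [← Finset.mul_sum]
    congr 1
    rw [← sum_smul_prod_ofFn_eq]
    refine Finset.sum_congr rfl fun p _ => ?_
    congr 1
    rw [Finset.prod_mul_distrib, prod_selector_eq b₁ b₂ hb f g p, Finset.prod_const, Finset.card_univ,
      Fintype.card_fin]
    ring
  · -- the other `M` slices are free
    have e : (List.ofFn fun τ : Fin M => ∑ p : Fin m → Fin 4,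
        ((if (τ.succ : Fin (M + 1)) = 0 then f (p b₁) * g (p b₂) else 1) * (1 / 4 : ℂ) ^ m) •
          (G * (List.ofFn fun b => S b (p b)).prod)) =
        List.ofFn fun _ : Fin M => G * (List.ofFn fun b => (1 / 4 : ℂ) • ∑ k, S b k).prod := by
      refine congrArg List.ofFn (funext fun τ => ?_)
      simp only [Fin.succ_ne_zero, ↓reduceIte, one_mul]
      rw [← avg_config_prod_eq_prod_avg, Finset.smul_sum, Finset.mul_sum]
      refine Finset.sum_congr rfl fun p _ => ?_
      rw [mul_smul_comm]
    rw [e, List.ofFn_const, List.prod_replicate]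

/-- **Registered form** (`stub_add`ed on stmt-14846 as `slavedEqualTimeFiniteIdentity`): the exact
finite-`M` identity `sum_insertion_slavedWeightBlocks_eq` with all parameters universally
quantified. [folklore] -/
theorem slavedEqualTimeFiniteIdentity : ∀ (n : Type) [Fintype n] [DecidableEq n] (m M : ℕ) (G : Matrix n n ℂ) (S : Fin m → Fin 4 → Matrix n n ℂ) (f g : Fin 4 → ℂ) (b₁ b₂ : Fin m), b₁ ≠ b₂ → (1 / 4 : ℂ) ^ (m * (M + 1)) • ∑ P : Fin (M + 1) → Fin m → Fin 4, (f (P 0 b₁) * g (P 0 b₂)) • (List.ofFn fun τ => G * (List.ofFn fun b => S b (P τ b)).prod).prod = (G * (List.ofFn fun b => ∑ k, ((1 / 4 : ℂ) * (if b = b₁ then f k else if b = b₂ then g k else 1)) • S b k).prod) * (G * (List.ofFn fun b => (1 / 4 : ℂ) • ∑ k, S b k).prod) ^ M :=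
  fun _ _ _ _ _ G S f g b₁ b₂ hb => sum_insertion_slavedWeightBlocks_eq G S f g b₁ b₂ hb

end Summit.HubbardSuperconductivity.HubbardSuperconductivity.Theorems

end
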